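import Literature.NumberTheory.PAdicHodge.BmaxPlusBdRModFil
import HarnessLib

/-!
# The comparison `B_max⁺ → B_dR⁺/Fil^k` sends Fontaine's `t = log[ε] ∈ B_max⁺` to `t = log[ε] ∈ B_dR⁺`

Topic `Literature/NumberTheory/PAdicHodge`; namespace `Literature.NumberTheory.PAdicHodge`. THEOREMS ONLY (no definition, no named
fact, no instance, no `sorry`). Sequel of `BmaxPlusBdRModFil` (`exists_bdR_lim_modFil`, `sub_mem_span_xiBdR_pow_of_bdR_lim_modFil`).
The element `tBmax ∈ B_max⁺(F)` is the `p`-ADIC limit of the partial sums `logSum N = Σ_{k≤N} (−1)^{k+1} u^k/k ∈ B⁰_max` (`BmaxPlusLog`),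
while `tBdR ∈ B_dR⁺(F)` is the `ξ`-ADIC limit of the same partial sums `logApprox N` (`BdRPlusLog`). Here:

* `algebraMap_coe_logSum` — **`ι₀(logSum N) = logApprox N`** in `B_dR⁺` (both are `N!⁻¹ · Λ_N(u)` with the integral truncated logarithm
  `Λ_N = N!·L_N ∈ ℤ[X]`);
* ★ `bdR_lim_modFil_tBmax` — **`tBdR` is a limit of `tBmax` modulo every `Fil^k`** in the sense of `exists_bdR_lim_modFil` (shift `k`):
  for `M ≥ N + k` and every representative `y` of `tBmax mod p^M`, `p^k (tBdR − ι₀ y) ∈ Λ(N, k)`; hence (`sub_mem_span_xiBdR_pow_of_bdR_lim_modFil`)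
  ★ `sub_tBdR_mem_of_bdR_lim_modFil_tBmax` — **every limit `L` of `tBmax` modulo `Fil^k` satisfies `L ≡ tBdR (mod ξ^k)`**: the comparison
  map `B_max⁺ → B_dR⁺` carries `t` to `t`.

Brick B5 of the φ-road of line `kato_lever` (crux K★ `stmt-BirchSwinnertonDyer-22226`); infrastructure only, BSD / K★ are not proved by this.

## References
* [Colmez1998Annals] P. Colmez, *Théorie d'Iwasawa des représentations de de Rham d'un corps local*, Ann. of Math. 148 (1998), §III.2.
* [FontaineAsterisque223III] J.-M. Fontaine, *Le corps des périodes p-adiques*, Astérisque 223 (1994), Exp. II §1.5.4.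
* [BergerLaurent2002] L. Berger, *Représentations p-adiques et équations différentielles*, Invent. Math. 148 (2002), §1.2.
-/

noncomputable section

open WittVector Field ValuativeRel Polynomial Finset
open scoped Nat
open Literature.AlgebraicGeometry.Resolution

namespace Literature.NumberTheory.PAdicHodge

open Literature.NumberTheory.GaloisRepresentations
open Literature.NumberTheory.GaloisRepresentations.IsNonarchimedeanLocalField
open TruncatedLog

variable {F : Type} [Field F] [ValuativeRel F] [TopologicalSpace F] [IsNonarchimedeanLocalField F]
  [CharZero F] {p : ℕ} [Fact p.Prime] [Fact (¬ IsUnit (p : integerC F))]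
  [IsAdicComplete (Ideal.span {(p : integerC F)}) (integerC F)]

omit [CharZero F] in
/-- `ι₀` as the ring map `(𝔸_inf[1/p] → B_dR⁺) ∘ val`. [folklore: unfolding] -/
private theorem comp_val_apply'' (y : bmaxZero F p) :
    ((algebraMap (Localization.Away (p : Ainf (p := p) F)) (BDeRhamPlus (integerC F) p)).comp (bmaxZero F p).val.toRingHom) y =
      algebraMap (Localization.Away (p : Ainf (p := p) F)) (BDeRhamPlus (integerC F) p) (y : Localization.Away (p : Ainf (p := p) F)) := rfl

omit [CharZero F] in
/-- `ι₀ ∘ (𝔸_inf → B⁰_max) = ι : 𝔸_inf → B_dR⁺`. [folklore: unfolding of the structure maps] -/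
private theorem algebraMap_coe_algebraMap'' (a : Ainf (p := p) F) :
    algebraMap (Localization.Away (p : Ainf (p := p) F)) (BDeRhamPlus (integerC F) p)
        ((algebraMap (Ainf (p := p) F) (bmaxZero F p) a : bmaxZero F p) : Localization.Away (p : Ainf (p := p) F)) =
      ainfToBdR a := rfl

/-- **`ι₀(logSum N) = logApprox N`**: the `p`-adic partial sums of `log[ε]` in `B⁰_max` map to the `ξ`-adic partial sums in `B_dR⁺`
(`N!·logSum N = Λ_N(u)` in `B⁰_max`, `Λ_N(u_dR) = N!·L_N(u_dR)` in the `ℚ`-algebra `B_dR⁺`, and `N!` is a unit of `B_dR⁺`).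
[cite: FontaineAsterisque223III, Exp. II §1.5.4] [cite: BergerLaurent2002, §1.2] -/
theorem algebraMap_coe_logSum (N : ℕ) :
    algebraMap (Localization.Away (p : Ainf (p := p) F)) (BDeRhamPlus (integerC F) p)
        ((logSum N : bmaxZero F p) : Localization.Away (p : Ainf (p := p) F)) = logApprox N := by
  have h := factorial_mul_logSum (F := F) (p := p) N
  have h1 := congrArg ((algebraMap (Localization.Away (p : Ainf (p := p) F)) (BDeRhamPlus (integerC F) p)).comp
    (bmaxZero F p).val.toRingHom) h
  rw [map_mul, map_natCast, comp_val_apply'', comp_val_apply'', algebraMap_coe_algebraMap'', ainfToBdR_aeval, ← ainfToBdR_uAinf.symm,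
    aeval_logTruncInt, ← logApprox_def] at h1
  exact (isUnit_natCast_bDeRhamPlus (F := F) (p := p) (Nat.factorial_ne_zero N)).mul_left_cancel h1

/-- ★ **`tBdR` is a limit of `tBmax` modulo every `Fil^k`** (in the sense of `exists_bdR_lim_modFil`, with shift `k`): for `M ≥ N + k` and
every representative `y ∈ B⁰_max` of `tBmax mod p^M`, `p^k (tBdR − ι₀(y)) ∈ Λ(N, k) = p^N ι(𝔸_inf) + ξ^k B_dR⁺`
(`y ≡ logSum(p^M − 1)`, `ι₀(logSum(p^M − 1)) = logApprox(p^M − 1) ≡ tBdR (mod ξ^{p^M − 1})`, `p^M − 1 ≥ k`).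
[cite: Colmez1998Annals, §III.2] [cite: FontaineAsterisque223III, Exp. II §1.5.4] -/
theorem bdR_lim_modFil_tBmax (k : ℕ) :
    ∀ N M : ℕ, N + k ≤ M → ∀ y : bmaxZero F p,
      AdicCompletion.evalₐ (Ideal.span {(p : bmaxZero F p)}) M (tBmax (F := F) (p := p)) = Ideal.Quotient.mk _ y →
      ∃ (a : Ainf (p := p) F) (w : BDeRhamPlus (integerC F) p),
        (p : BDeRhamPlus (integerC F) p) ^ k *
            (tBdR - algebraMap (Localization.Away (p : Ainf (p := p) F)) (BDeRhamPlus (integerC F) p)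
              (y : Localization.Away (p : Ainf (p := p) F))) =
          ainfToBdR ((p : Ainf (p := p) F) ^ N * a) + xiBdR ^ k * w := by
  intro N M hM y hy
  have hp := (Fact.out : p.Prime)
  -- `y − logSum(p^M − 1) ∈ p^M B⁰_max ⊆ p^N B⁰_max`
  have hsub : logSum (p ^ M - 1) - y ∈ Ideal.span {(p : bmaxZero F p)} ^ N :=
    Ideal.pow_le_pow_right (show N ≤ M by omega) (sub_mem_pow_of_evalₐ_eq le_rfl hy (evalₐ_tBmax M))
  obtain ⟨a, w, e⟩ := exists_natCast_pow_mul_algebraMap_coe_eq_of_mem_pow hsub k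
  -- `logApprox(p^M − 1) − tBdR ∈ ξ^{p^M − 1} ⊆ ξ^k`
  have hkM : k ≤ p ^ M - 1 := by
    have h1 : M < p ^ M := Nat.lt_pow_self hp.one_lt
    omega
  have hdR : (logApprox (p ^ M - 1) - tBdR : BDeRhamPlus (integerC F) p) ∈ Ideal.span {(xiBdR : BDeRhamPlus (integerC F) p)} ^ k :=
    Ideal.pow_le_pow_right hkM (logApprox_sub_tBdR_mem _)
  rw [Ideal.span_singleton_pow, Ideal.mem_span_singleton'] at hdR
  obtain ⟨w', hw'⟩ := hdR
  refine ⟨a, w - (p : BDeRhamPlus (integerC F) p) ^ k * w', ?_⟩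
  have e0 : algebraMap (Localization.Away (p : Ainf (p := p) F)) (BDeRhamPlus (integerC F) p)
      ((logSum (p ^ M - 1) - y : bmaxZero F p) : Localization.Away (p : Ainf (p := p) F)) =
      logApprox (p ^ M - 1) -
        algebraMap (Localization.Away (p : Ainf (p := p) F)) (BDeRhamPlus (integerC F) p) (y : Localization.Away (p : Ainf (p := p) F)) := by
    rw [← comp_val_apply'', map_sub, comp_val_apply'', comp_val_apply'', algebraMap_coe_logSum]
  rw [e0] at e
  linear_combination e + ((p : BDeRhamPlus (integerC F) p) ^ k) * hw'

/-- ★ **The comparison sends `t` to `t`**: every limit `L` of `tBmax` modulo `Fil^k` (as produced by `exists_bdR_lim_modFil`, any shift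
`r`) satisfies `L − tBdR ∈ ξ^k B_dR⁺`. [cite: Colmez1998Annals, §III.2] [cite: FontaineAsterisque223III, Exp. II §1.5.4] -/
theorem sub_tBdR_mem_of_bdR_lim_modFil_tBmax {k : ℕ} {L : BDeRhamPlus (integerC F) p} {r : ℕ}
    (h : ∀ N M : ℕ, N + r ≤ M → ∀ y : bmaxZero F p,
      AdicCompletion.evalₐ (Ideal.span {(p : bmaxZero F p)}) M (tBmax (F := F) (p := p)) = Ideal.Quotient.mk _ y →
      ∃ (a : Ainf (p := p) F) (w : BDeRhamPlus (integerC F) p),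
        (p : BDeRhamPlus (integerC F) p) ^ k *
            (L - algebraMap (Localization.Away (p : Ainf (p := p) F)) (BDeRhamPlus (integerC F) p)
              (y : Localization.Away (p : Ainf (p := p) F))) =
          ainfToBdR ((p : Ainf (p := p) F) ^ N * a) + xiBdR ^ k * w) :
    L - tBdR ∈ Ideal.span {(xiBdR : BDeRhamPlus (integerC F) p) ^ k} :=
  sub_mem_span_xiBdR_pow_of_bdR_lim_modFil h (bdR_lim_modFil_tBmax k)

end Literature.NumberTheory.PAdicHodge

end
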